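import Literature.Geometry.Riemannian.SimpleManifoldBallDomain
import Literature.Geometry.Riemannian.SimpleManifoldBallCovering
import HarnessLib

/-!
# `exp_x : D_x → D` is a homeomorphism for a simple sublevel domain (PSU Prop. 3.8.5, topological part)

Setting of `SimpleManifoldBallExitTime.lean` / `SimpleManifoldBallDomain.lean` (compact `M` modelled
on a finite-dimensional real inner product space `E`, `C^∞` Riemannian `g`, `C^∞` `ρ`, `D = {ρ ≤ 0}`
strictly convex and non-trapping, interior point `x₀`), now WITHOUT CONJUGATE POINTS in `D`
(`HasNoConjugatePointsSublevel g ρ`) and with `D` connected. Paternain–Salo–Uhlmann 2023,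
Prop. 3.8.5: "`exp_x : D_x → M` is a diffeomorphism. In particular, `M` is diffeomorphic to a
closed ball." — proof: bijective (Prop. 3.8.4) + local diffeomorphism (Cor. 3.7.11). Here, for
`exp = expMap g.leviCivita x₀` on `D_{x₀} = {u | γ_u([0,1]) ⊆ D}`:

* `exists_openPartialHomeomorph_expMap`: at every `u ∈ D_{x₀}`, `exp` is a local diffeomorphism
  of `E` into `M` (Cor. 3.7.11: `mfderiv_expMap_injective_of_hasNoConjugatePoints` + the inverse
  function theorem in the chart at `exp u`), with `C^∞` local inverse at `exp u`;
* `exists_nhds_mem_expDomain_of_expMap_mem`: near `u ∈ D_{x₀}`, `exp v ∈ D ⇒ v ∈ D_{x₀}` (interior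
  points: openness of `U_{x₀}`; exit points: the exit is transversal, so `t ↦ ρ(γ_v(t))` increases
  near `t = 1` for `v` near `u`) — the boundary behaviour replacing "`D_x` has smooth boundary";
* `isLocalHomeomorph_expMap_restrict`: the induced map `p : D_{x₀} → D` is a local homeomorphism;
* `injective_expMap_restrict` (by `injective_of_isLocalHomeomorph_of_homeomorph_closedBall`, the
  covering/Brouwer replacement of Prop. 3.8.4, on `D_{x₀} ≃ₜ B̄` from
  `exists_homeomorph_radial_closedBall`), `surjective_expMap_restrict` (the image is clopen in
  the connected `D`), `exists_homeomorph_expDomain` (`D_{x₀} ≃ₜ D` given by `exp`) and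
  **`exists_homeomorph_sublevel_closedBall`: `D ≃ₜ B̄`** — the first conclusion of
  `PaternainSaloUhlmann2023_simple_sublevel_ball`.

No definitions, no named facts.

## References

* G. P. Paternain, M. Salo, G. Uhlmann, *Geometric Inverse Problems* (2023), Cor. 3.7.11,
  Prop. 3.8.4, Prop. 3.8.5 (PDF pp. 91, 96–97).
-/

noncomputable section

open Bundle Set Filter Function Metric
open scoped Manifold ContDiff Topology

namespace Literature.Geometry.Riemannian

open Literature.Geometry.Lorentzian

variable {E : Type*} [NormedAddCommGroup E] [InnerProductSpace ℝ E] [FiniteDimensional ℝ E]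
  [CompleteSpace E] {M : Type*} [TopologicalSpace M] [ChartedSpace E M]
  [IsManifold 𝓘(ℝ, E) ∞ M] [T2Space M] [CompactSpace M]
  {g : PseudoRiemannianMetric 𝓘(ℝ, E) ∞ E (TangentSpace 𝓘(ℝ, E) : M → Type _)}
  [g.HasLeviCivita] {ρ : M → ℝ} {x₀ : M}

/-! ### `exp` is smooth, and on `D_{x₀}` a local diffeomorphism -/

/-- `exp_{x₀}` is `C^∞` (the metric being smooth and complete). [cite: LeeRiemannianManifolds2018, Prop. 5.19] -/
theorem contMDiff_expMap_smooth (hg : g.IsRiemannian) :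
    ContMDiff 𝓘(ℝ, E) 𝓘(ℝ, E) ∞
      (fun u : E ↦ expMap g.leviCivita x₀ u) := by
  haveI := contMDiffCovariantDerivative_leviCivita_smooth g
  haveI := contMDiffCovariantDerivative_leviCivita_smooth_infty g
  exact contMDiff_expMap_infty (isGeodesicallyComplete_of_smooth g hg) x₀

/-- `exp_{x₀} u = γ_u(1)`. [cite: LeeRiemannianManifolds2018, p. 127] -/
theorem expMap_eq_maximalGeodesic_one' (hg : g.IsRiemannian) (u : E) :
    expMap g.leviCivita x₀ u =
      maximalGeodesic g.leviCivita x₀ u 1 := by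
  haveI := contMDiffCovariantDerivative_leviCivita_smooth g
  exact expMap_eq_maximalGeodesic (isGeodesicallyComplete_of_smooth g hg) x₀ _

/-- `exp` maps `D_{x₀}` into `D`. [folklore] -/
theorem expMap_mem_sublevel (hg : g.IsRiemannian) {u : E}
    (hu : ∀ t ∈ Icc (0 : ℝ) 1,
      ρ (maximalGeodesic g.leviCivita x₀ u t) ≤ 0) :
    ρ (expMap g.leviCivita x₀ u) ≤ 0 := by
  rw [expMap_eq_maximalGeodesic_one' hg]
  exact hu 1 ⟨zero_le_one, le_rfl⟩

/-- **`exp` is a local diffeomorphism at every point of `D_{x₀}`** (PSU Cor. 3.7.11 in the proof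
of Prop. 3.8.5): there is an open partial homeomorphism `Φ` of `E` to `M` around `u ∈ D_{x₀}`
agreeing with `exp` on its source, whose inverse is `C^∞` at `exp u`. Proof: the differential of
`exp` at `u` is injective (`mfderiv_expMap_injective_of_hasNoConjugatePoints`), so the chart
expression `ψ ∘ exp` (`ψ` the chart at `exp u`) has invertible derivative at `u`; inverse function
theorem. [cite: PaternainSaloUhlmann2023, Cor. 3.7.11] -/
theorem exists_openPartialHomeomorph_expMap (hg : g.IsRiemannian)
    (hnc : HasNoConjugatePointsSublevel g ρ) {u : E}
    (hu : ∀ t ∈ Icc (0 : ℝ) 1,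
      ρ (maximalGeodesic g.leviCivita x₀ u t) ≤ 0) :
    ∃ Φ : OpenPartialHomeomorph E M, u ∈ Φ.source ∧
      (∀ v ∈ Φ.source, Φ v = expMap g.leviCivita x₀ v) ∧
      ContMDiffAt 𝓘(ℝ, E) 𝓘(ℝ, E) ∞ Φ.symm
        (expMap g.leviCivita x₀ u) := by
  haveI := contMDiffCovariantDerivative_leviCivita_smooth g
  have hc := isGeodesicallyComplete_of_smooth g hg
  set ex : E → M := fun u : E ↦ expMap g.leviCivita x₀ u
    with hex_def
  have hexs : ContMDiff 𝓘(ℝ, E) 𝓘(ℝ, E) ∞ ex := contMDiff_expMap_smooth hg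
  have hinj : Injective (mfderiv 𝓘(ℝ, E) 𝓘(ℝ, E) ex u) :=
    mfderiv_expMap_injective_of_hasNoConjugatePoints g hc hnc hu
  -- the chart at `exp u` and the chart expression `f = ψ ∘ exp`
  set y := ex u with hy_def
  set ψ := extChartAt 𝓘(ℝ, E) y with hψ_def
  set W : Set E := ex ⁻¹' (chartAt E y).source with hW_def
  have hWo : IsOpen W := (chartAt E y).open_source.preimage hexs.continuous
  have huW : u ∈ W := mem_chart_source E y
  set f : E → E := ψ ∘ ex with hf_def
  have hfs : ∀ v ∈ W, ContDiffAt ℝ ∞ f v := by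
    intro v hv
    have h1 : ContMDiffAt 𝓘(ℝ, E) 𝓘(ℝ, E) ∞ ψ (ex v) := contMDiffAt_extChartAt' hv
    exact contMDiffAt_iff_contDiffAt.1 (h1.comp v (hexs v))
  -- the derivative of `f` at `u` is invertible
  have hψd : HasMFDerivAt 𝓘(ℝ, E) 𝓘(ℝ, E) ψ y (mfderiv 𝓘(ℝ, E) 𝓘(ℝ, E) ψ y) :=
    (hasMFDerivAt_extChartAt (I := 𝓘(ℝ, E)) (mem_chart_source E y))
  have hfd : HasMFDerivAt 𝓘(ℝ, E) 𝓘(ℝ, E) f u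
      ((mfderiv 𝓘(ℝ, E) 𝓘(ℝ, E) ψ y).comp (mfderiv 𝓘(ℝ, E) 𝓘(ℝ, E) ex u)) :=
    hψd.comp u ((hexs u).mdifferentiableAt (by simp)).hasMFDerivAt
  have hfd' : HasFDerivAt f ((mfderiv 𝓘(ℝ, E) 𝓘(ℝ, E) ψ y).comp (mfderiv 𝓘(ℝ, E) 𝓘(ℝ, E) ex u)) u :=
    hasMFDerivAt_iff_hasFDerivAt.1 hfd
  have hψinv : (mfderiv 𝓘(ℝ, E) 𝓘(ℝ, E) ψ y).IsInvertible :=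
    isInvertible_mfderiv_extChartAt (mem_extChartAt_source y)
  set B : E →L[ℝ] E := (mfderiv 𝓘(ℝ, E) 𝓘(ℝ, E) ψ y).comp (mfderiv 𝓘(ℝ, E) 𝓘(ℝ, E) ex u)
    with hB_def
  have hBinj : Injective (B : E →ₗ[ℝ] E) := by
    intro w₁ w₂ h
    exact hinj (hψinv.injective h)
  have hker : LinearMap.ker (B : E →ₗ[ℝ] E) = ⊥ := LinearMap.ker_eq_bot.2 hBinj
  have hrange : LinearMap.range (B : E →ₗ[ℝ] E) = ⊤ :=
    LinearMap.range_eq_top.2 ((B : E →ₗ[ℝ] E).injective_iff_surjective.1 hBinj)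
  set A : E ≃L[ℝ] E := ContinuousLinearEquiv.ofBijective B hker hrange with hA_def
  have hA : HasFDerivAt f (A : E →L[ℝ] E) u := by
    rw [hA_def, ContinuousLinearEquiv.coe_ofBijective]
    exact hfd'
  -- inverse function theorem
  set e := (hfs u huW).toOpenPartialHomeomorph f hA (by simp) with he_def
  have he_coe : (e : E → E) = f := rfl
  have hue : u ∈ e.source := (hfs u huW).mem_toOpenPartialHomeomorph_source hA (by simp)
  -- restrict to `W` and compose with the inverse chart
  set e' := e.restrOpen W hWo with he'_def
  set Φ := e'.trans (chartAt E y).symm with hΦ_def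
  have hψW : ∀ v ∈ W, ψ (ex v) = chartAt E y (ex v) := fun v _ ↦ by
    simp [hψ_def]
  have hΦsource : ∀ v, v ∈ Φ.source ↔ v ∈ e.source ∧ v ∈ W := by
    intro v
    simp only [hΦ_def, he'_def, OpenPartialHomeomorph.trans_source, OpenPartialHomeomorph.restrOpen_source,
      OpenPartialHomeomorph.symm_source, mem_inter_iff, mem_preimage]
    constructor
    · rintro ⟨⟨h1, h2⟩, -⟩; exact ⟨h1, h2⟩
    · rintro ⟨h1, h2⟩
      refine ⟨⟨h1, h2⟩, ?_⟩
      show e v ∈ (chartAt E y).target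
      rw [he_coe, hf_def, comp_apply, hψW v h2]
      exact (chartAt E y).map_source h2
  have hΦapply : ∀ v ∈ Φ.source, Φ v = ex v := by
    intro v hv
    obtain ⟨-, hvW⟩ := (hΦsource v).1 hv
    show (chartAt E y).symm (e v) = ex v
    rw [he_coe, hf_def, comp_apply, hψW v hvW]
    exact (chartAt E y).left_inv hvW
  refine ⟨Φ, (hΦsource u).2 ⟨hue, huW⟩, hΦapply, ?_⟩
  -- smoothness of the inverse at `exp u`: `Φ.symm = e.symm ∘ ψ` there
  have hsymm : (Φ.symm : M → E) = e.symm ∘ (chartAt E y : M → E) := by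
    funext z
    rfl
  have hinv : ContDiffAt ℝ ∞ e.symm (f u) := (hfs u huW).to_localInverse hA (by simp)
  have hψu : ContMDiffAt 𝓘(ℝ, E) 𝓘(ℝ, E) ∞ (chartAt E y : M → E) y :=
    (contMDiffOn_chart (x := y)).contMDiffAt ((chartAt E y).open_source.mem_nhds (mem_chart_source E y))
  rw [hsymm]
  refine ContMDiffAt.comp_of_eq (contMDiffAt_iff_contDiffAt.2 hinv) hψu ?_
  show chartAt E y y = f u
  rw [hf_def, comp_apply, hψW u huW]

/-! ### Near `u ∈ D_{x₀}`: `exp v ∈ D ⇒ v ∈ D_{x₀}` -/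

/-- **Boundary behaviour of `exp` on `D_{x₀}`**: every `u ∈ D_{x₀}` has a neighbourhood `N` such
that `v ∈ N` with `exp v ∈ D` lies in `D_{x₀}`. If `exp u` is interior (`ρ < 0`) then `u ∈ U_{x₀}`,
which is open and contained in `D_{x₀}`; if `exp u ∈ ∂D` (`ρ = 0`, so `R u = 1`) the exit is
transversal (`dρ(γ_u'(1)) > 0`), hence `t ↦ ρ(γ_v(t))` is increasing near `t = 1` for `v` near `u`,
while `ρ(γ_v(t)) < 0` for `t ≤ 1 - δ/2`; so `ρ(exp v) ≤ 0` forces `ρ(γ_v(t)) ≤ 0` on `[0, 1]`.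
[cite: PaternainSaloUhlmann2023, Lemma 3.2.3 and Prop. 3.8.5 (proof)] -/
theorem exists_nhds_mem_expDomain_of_expMap_mem (hg : g.IsRiemannian)
    (hρ : ContMDiff 𝓘(ℝ, E) 𝓘(ℝ, ℝ) ∞ ρ) (hconv : IsStrictlyConvexSublevel g ρ)
    (hnt : IsNonTrappingSublevel g ρ) (hx₀ : ρ x₀ < 0) {u : E}
    (hu : ∀ t ∈ Icc (0 : ℝ) 1,
      ρ (maximalGeodesic g.leviCivita x₀ u t) ≤ 0) :
    ∃ N : Set E, IsOpen N ∧ u ∈ N ∧ ∀ v ∈ N,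
      ρ (expMap g.leviCivita x₀ v) ≤ 0 →
        ∀ t ∈ Icc (0 : ℝ) 1,
          ρ (maximalGeodesic g.leviCivita x₀ v t) ≤ 0 := by
  haveI := contMDiffCovariantDerivative_leviCivita_smooth g
  have hc := isGeodesicallyComplete_of_smooth g hg
  have hρc := hρ.continuous
  -- the family `G (t, v) = ρ (γ_v t)` is smooth
  set G : ℝ × E → ℝ := fun q ↦
    ρ (maximalGeodesic g.leviCivita x₀ q.2 q.1) with hG_def
  haveI := contMDiffCovariantDerivative_leviCivita_smooth_infty g
  have hGm : ContMDiff (𝓘(ℝ, ℝ).prod 𝓘(ℝ, E)) 𝓘(ℝ, ℝ) ∞ G :=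
    hρ.comp (contMDiff_maximalGeodesic_family hc x₀)
  have hGs : ContDiff ℝ ∞ G := by
    have h : ContMDiff 𝓘(ℝ, ℝ × E) 𝓘(ℝ, ℝ) ∞ G := by
      rw [modelWithCornersSelf_prod, ← chartedSpaceSelf_prod]; exact hGm
    exact contMDiff_iff_contDiff.1 h
  have hGc : Continuous G := hGs.continuous
  by_cases hint : ρ (expMap g.leviCivita x₀ u) < 0
  · -- interior point: `u ∈ U_{x₀}`, open
    have huU : ∀ t ∈ Icc (0 : ℝ) 1,
        ρ (maximalGeodesic g.leviCivita x₀ u t) < 0 := by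
      rw [expMap_eq_maximalGeodesic_one' hg] at hint
      by_cases hu0 : u = 0
      · subst hu0
        exact zero_mem_expDomainInterior hg hx₀
      · intro t ht
        rcases ht.2.lt_or_eq with hlt | heq
        · have h1 : (1 : ℝ) ≤ sSup {a : ℝ | 0 ≤ a ∧ ∀ t ∈ Icc (0 : ℝ) a,
              ρ (maximalGeodesic g.leviCivita x₀ u t) ≤ 0} :=
            (mem_exitSet_iff_le_sSup hg hρc hnt hx₀.le hu0 zero_le_one).1 ⟨zero_le_one, hu⟩
          exact apply_lt_zero_of_lt_sSup_exitSet hg hρ hconv hnt hx₀ hu0 ht.1 (lt_of_lt_of_le hlt h1)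
        · rw [heq]; exact hint
    refine ⟨{v : E | ∀ t ∈ Icc (0 : ℝ) 1,
        ρ (maximalGeodesic g.leviCivita x₀ v t) < 0},
      isOpen_expDomainInterior hg hρ hconv hnt hx₀, huU, fun v hv _ ↦ ?_⟩
    exact expDomainInterior_subset_expDomain hv
  · -- exit point: `ρ (exp u) = 0`, `u ≠ 0`, `R u = 1`
    push Not at hint
    have h0 : ρ (expMap g.leviCivita x₀ u) = 0 :=
      le_antisymm (expMap_mem_sublevel hg hu) hint
    rw [expMap_eq_maximalGeodesic_one' hg] at h0
    have hu0 : u ≠ 0 := by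
      rintro rfl
      have := zero_mem_expDomainInterior hg hx₀ (x₀ := x₀) (ρ := ρ) 1 ⟨zero_le_one, le_rfl⟩
      exact absurd h0 (ne_of_lt this)
    set R := sSup {a : ℝ | 0 ≤ a ∧ ∀ t ∈ Icc (0 : ℝ) a,
      ρ (maximalGeodesic g.leviCivita x₀ u t) ≤ 0} with hR_def
    have hR1 : R = 1 := by
      have h1 : (1 : ℝ) ≤ R :=
        (mem_exitSet_iff_le_sSup hg hρc hnt hx₀.le hu0 zero_le_one).1 ⟨zero_le_one, hu⟩
      rcases h1.lt_or_eq with hlt | heq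
      · exact absurd h0 (ne_of_lt
          (apply_lt_zero_of_lt_sSup_exitSet hg hρ hconv hnt hx₀ hu0 zero_le_one hlt))
      · exact heq.symm
    -- transversality at `t = 1`
    obtain ⟨hγ, hγ0, hγv⟩ := isGeodesic_maximalGeodesic hc x₀ u
    have htrans := mvfderiv_velocity_pos_at_sSup_exitSet hg hρ hconv hnt hx₀ hu0 (x₀ := x₀)
    rw [← hR_def, hR1] at htrans
    -- the `t`-derivative of `G` and its positivity near `(1, u)`
    have hGd : ∀ q : ℝ × E, HasDerivAt (fun t ↦ G (t, q.2)) (fderiv ℝ G q (1, 0)) q.1 := by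
      intro q
      have h1 : HasFDerivAt G (fderiv ℝ G q) q := (hGs.differentiable (by simp) q).hasFDerivAt
      have h2 : HasDerivAt (fun t : ℝ ↦ ((t, q.2) : ℝ × E)) ((1 : ℝ), (0 : E)) q.1 := by
        refine HasDerivAt.prodMk (hasDerivAt_id q.1) (hasDerivAt_const q.1 q.2)
      exact h1.comp_hasDerivAt_of_eq q.1 h2 (by simp)
    have hderiv1 : fderiv ℝ G (1, u) (1, 0) =
        mvfderiv 𝓘(ℝ, E) ρ (maximalGeodesic g.leviCivita x₀ u 1)
          (velocity 𝓘(ℝ, E) (maximalGeodesic g.leviCivita x₀ u) 1) := by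
      have h1 := hGd (1, u)
      have h2 : HasDerivAt (fun t ↦ G (t, u))
          (mvfderiv 𝓘(ℝ, E) ρ (maximalGeodesic g.leviCivita x₀ u 1)
            (velocity 𝓘(ℝ, E) (maximalGeodesic g.leviCivita x₀ u) 1)) 1 :=
        hasDerivAt_comp_curve_mvfderiv ((hρ _).mdifferentiableAt (by simp))
          (IsGeodesicOn.mdifferentiableAt_holds hγ (mem_univ _))
      exact h1.unique h2
    have hpos : 0 < fderiv ℝ G (1, u) (1, 0) := by rw [hderiv1]; exact htrans
    have hDc : Continuous fun q : ℝ × E ↦ fderiv ℝ G q (1, 0) :=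
      (hGs.continuous_fderiv (by simp)).clm_apply continuous_const
    -- a product neighbourhood `Ioo (1-δ) (1+δ) × N₁` where `∂_t G > 0`
    have hev : ∀ᶠ q : ℝ × E in 𝓝 (1, u), 0 < fderiv ℝ G q (1, 0) :=
      hDc.continuousAt.eventually (lt_mem_nhds hpos)
    obtain ⟨δ, hδ, N₁, hN₁, hprod⟩ : ∃ δ > (0 : ℝ), ∃ N₁ ∈ 𝓝 u,
        ∀ t, |t - 1| < δ → ∀ v ∈ N₁, 0 < fderiv ℝ G (t, v) (1, 0) := by
      obtain ⟨T, N₁, hTo, hT1, hN₁o, huN₁, hsub⟩ := mem_nhds_prod_iff'.1 hev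
      obtain ⟨δ, hδ, hδT⟩ := Metric.isOpen_iff.1 hTo 1 hT1
      refine ⟨δ, hδ, N₁, hN₁o.mem_nhds huN₁, fun t ht v hv ↦ hsub (mk_mem_prod (hδT ?_) hv)⟩
      rw [mem_ball, Real.dist_eq]
      exact ht
    -- `G (t, v) < 0` for `t ∈ [0, 1 - δ/2]`, `v` near `u`
    have hneg : ∀ t ∈ Icc (0 : ℝ) (1 - δ / 2), G (t, u) < 0 := fun t ht ↦
      apply_lt_zero_of_lt_sSup_exitSet hg hρ hconv hnt hx₀ hu0 ht.1
        (by rw [← hR_def, hR1]; linarith [ht.2])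
    have hev2 : ∀ᶠ v in 𝓝 u, ∀ t ∈ Icc (0 : ℝ) (1 - δ / 2), G (t, v) < 0 := by
      refine (isCompact_Icc (a := (0 : ℝ)) (b := 1 - δ / 2)).eventually_forall_of_forall_eventually
        (P := fun (v : E) (t : ℝ) ↦ G (t, v) < 0) fun t ht ↦ ?_
      have hc2 : Continuous fun z : E × ℝ ↦ G (z.2, z.1) := hGc.comp (continuous_snd.prodMk continuous_fst)
      exact hc2.continuousAt.eventually (gt_mem_nhds (hneg t ht))
    obtain ⟨N₂, hN₂, hN₂o, huN₂⟩ := _root_.mem_nhds_iff.1 hev2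
    obtain ⟨N₁', hN₁', hN₁'o, huN₁'⟩ := _root_.mem_nhds_iff.1 hN₁
    refine ⟨N₁' ∩ N₂, hN₁'o.inter hN₂o, ⟨huN₁', huN₂⟩, fun v hv hvD t ht ↦ ?_⟩
    rw [expMap_eq_maximalGeodesic_one' hg] at hvD
    by_cases htδ : t ≤ 1 - δ / 2
    · exact (hN₂ hv.2 t ⟨ht.1, htδ⟩).le
    · push Not at htδ
      -- `G (·, v)` is increasing on `(1 - δ, 1 + δ)`
      have hmono : StrictMonoOn (fun t ↦ G (t, v)) (Ioo (1 - δ) (1 + δ)) := by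
        refine strictMonoOn_of_deriv_pos (convex_Ioo _ _)
          (fun t _ ↦ (hGd (t, v)).continuousAt.continuousWithinAt) fun t ht' ↦ ?_
        rw [interior_Ioo] at ht'
        rw [(hGd (t, v)).deriv]
        exact hprod t (by rw [abs_lt]; constructor <;> linarith [ht'.1, ht'.2]) v (hN₁' hv.1)
      have hle : G (t, v) ≤ G (1, v) := by
        rcases ht.2.lt_or_eq with hlt | heq
        · exact (hmono ⟨by linarith, by linarith⟩ ⟨by linarith, by linarith⟩ hlt).le
        · rw [heq]
      exact hle.trans hvD

end Literature.Geometry.Riemannian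

end
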